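import Mathlib
import Literature.Analysis.FluidPDE.BoltzmannEquation
import Literature.MathematicalPhysics.KineticTheory.Hilbert6Wave0
import HarnessLib

/-!
# EntropyProductionBounds

Topic `Literature/MathematicalPhysics/KineticTheory`. Named literature fact(s) relocated by the gate from `Summits/AtomisticToContinuum/HydrodynamicLimit/Theorems/CollisionIsometryCLTAdaptedWeightCLTBHEEPClosureCell.lean`
(accept-time relocation of `[cite]`d propositions written inline in a Summits proposal; human ruling 2026-08-15).
Sources: RezakhanlouVillani2008.

* `Literature.MathematicalPhysics.KineticTheory.HardSphereEEP`
-/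

namespace Literature.MathematicalPhysics.KineticTheory

open scoped BigOperators
open MeasureTheory

/-- **Entropy–entropy-production (EEP) inequality for the hard-sphere Boltzmann collision operator** — a THEOREM of
Villani, Comm. Math. Phys. 234 (2003) 455–490, Thm 2.1; lecture-note statement (page-verified): Rezakhanlou–Villani,
*Entropy Methods for the Boltzmann Equation*, LNM 1916 (2008), Ch. 1 §1.4.2 Theorem 4, pp. 25–26 (Comment 4: "all
constants `K_ε` appearing in this theorem are explicit").
PRINTED THEOREM (Thm 4). Let `B(v − v_*, σ) ≥ K_B inf(|v − v_*|^γ, |v − v_*|^{-β})` for some `β, γ ≥ 0` (hard spheres: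
`B = |v − v_*|`, `γ = 1`, `β = 0`). Then for all `ε > 0`: `∀ ρ₀ ∀ A₀ ∀ q₀ ∃ k ∃ s ∀ S ∀ M ∃ K_ε > 0` such that
`[‖f‖_{H^k} ≤ S, ‖f‖_{L¹_s} ≤ M, f ≥ ρ₀ e^{−A₀|v|^{q₀}}] ⟹ D(f) ≥ K_ε H(f | M)^{1+ε}` for densities `f` on `ℝ³` of the
normalised class `𝒞(1,0,1)` (unit mass, zero mean, unit temperature; `M` the standard Maxwellian), with
`D(f) = ¼ ∫ (f′f′_* − f f_*) log (f′f′_*/(f f_*)) B dσ dv dv_*` the entropy production and `H(f | M) = ∫ f log(f/M)`;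
general mass/momentum/temperature `(1, u, T)` by the change of variables `f̃(v) = T^{3/2} f(u + √T v)` (ibid. p. 23:
`H(f | M^f) = H(f̃ | M)`, `D(f) = √T · D(f̃)` for hard spheres, `M^f` the Maxwellian with the parameters of `f`).
SPECIAL CASE STATED HERE — TODO(general form): the general statement needs Sobolev norms `H^k(ℝ³)` of velocity
densities, which the tree does not yet have. We state the consequence for the REGULARISED LAWS OF VELOCITY CLOUDS
`f̂ = (1 − δ) Σ_i p_i G_h(· − v_i) + δ M_{1,T,ū}` (probability weights `p_i ≥ 0`, `Σ p_i = 1`, velocities `v_i ∈ ℝ³`,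
Gaussian mollifier `G_h(· − c) = localMaxwellian 1 h² c`, `ū = Σ p_i v_i`, `T = Σ p_i |v_i − ū|²/3 + h²`, `0 < h ≤ 1`,
`0 < δ < 1`) under the uniform Gaussian moment bound `Σ p_i exp(λ|v_i|²) ≤ R`, with a constant depending only on
`(ε, h, δ, λ, R)`. WHY THIS IS A CONSEQUENCE: `M^{f̂} = M_{1,T,ū}` exactly (unit mass, mean `ū`, energy
`(1−δ)(3(T − h²) + 3h²) + 3δT = 3T`), and the normalised law `f̃ = (1−δ) Σ p_i G_{h/√T}(· − ṽ_i) + δ M_{1,1,0}`,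
`ṽ_i = (v_i − ū)/√T`, satisfies the three hypotheses of Thm 4 with constants depending only on `(h, δ, λ, R)`:
(lower bound) `f̃ ≥ δ M_{1,1,0} = δ (2π)^{-3/2} e^{−|v|²/2}` (`ρ₀ = δ(2π)^{-3/2}`, `A₀ = ½`, `q₀ = 2`); (smoothness) by
Minkowski's inequality the `H^k` norm of a probability mixture of translates of `G_{h/√T}` is at most `‖G_{h/√T}‖_{H^k}`,
bounded for `h/√T ∈ [h (R/λ + 1)^{-1/2}, 1]` (`h² ≤ T ≤ Σ p_i|v_i|²/3 + 1 ≤ R/λ + 1` as `λ|v|² ≤ e^{λ|v|²}`); (moments)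
`∫ f̃ |v|^s ≤ C(s, h, λ, R)` since `|v|^s ≤ C_{s,λ} e^{λ|v|²}` and Gaussian moments are finite. Then
`D(f̂) = √T D(f̃) ≥ h K_ε H(f̂ | M_{1,T,ū})^{1+ε}`; the tree's `entropyProduction hardSphereKernel` uses the kernel
`((v − v_*)·ω)₊` in the `ω`-representation, a fixed positive multiple of Thm 4's `D` for `B = |v − v_*|`, absorbed in `K`.
Primary source: Villani, Comm. Math. Phys. 234 (2003) 455–490 (bib key `Villani2003Cercignani`, Thm 2.1); the tag
below points at the page-verified lecture-note statement.
[cite: RezakhanlouVillani2008, Ch. 1 §1.4.2 Thm 4 pp. 25–26] [file MathematicalPhysics/KineticTheory/EntropyProductionBounds] -/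
def HardSphereEEP : Prop :=
  ∀ (ε h δ lam R : ℝ), 0 < ε → 0 < h → h ≤ 1 → 0 < δ → δ < 1 → 0 < lam →
    ∃ K : ℝ, 0 < K ∧ ∀ (n : ℕ) (p : Fin n → ℝ) (v : Fin n → EuclideanSpace ℝ (Fin 3)),
      (∀ i, 0 ≤ p i) → ∑ i, p i = 1 → ∑ i, p i * Real.exp (lam * ‖v i‖ ^ 2) ≤ R →
        let u : EuclideanSpace ℝ (Fin 3) := ∑ l, p l • v l
        let T : ℝ := (∑ i, p i * ‖v i - u‖ ^ 2) / 3 + h ^ 2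
        let M : EuclideanSpace ℝ (Fin 3) → ℝ := fun w => Literature.Analysis.FluidPDE.localMaxwellian 1 T u w
        let f : EuclideanSpace ℝ (Fin 3) → ℝ := fun w =>
          (1 - δ) * (∑ i, p i * Literature.Analysis.FluidPDE.localMaxwellian 1 (h ^ 2) (v i) w) + δ * M w
        K * (∫ w, f w * Real.log (f w / M w)) ^ (1 + ε) ≤
          Literature.Analysis.FluidPDE.entropyProduction Literature.MathematicalPhysics.KineticTheory.hardSphereKernel f
-- TODO(general form): Rezakhanlou–Villani LNM 1916 Ch. 1 Thm 4 (= Villani 2003 Thm 2.1) for EVERY density `f` on `ℝ³` with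
-- `‖f‖_{H^k} ≤ S`, `‖f‖_{L¹_s} ≤ M`, `f ≥ ρ₀ e^{−A₀|v|^{q₀}}` (and general kernels `B ≥ K_B min(|z|^γ, |z|^{-β})`); it needs
-- Sobolev norms `H^k(ℝ³)` of velocity densities, which the tree does not have yet.

end Literature.MathematicalPhysics.KineticTheory
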